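import Literature.Geometry.Hyperkaehler.Hyperholomorphic
import Literature.Geometry.Kaehler.AnalyticSetRegular
import Literature.NumberTheory.Transcendental.FormsAlgebra
import HarnessLib

/-!
# Trianalytic subvarieties of a hyperkähler manifold

Definition item `defn-TrianalyticSubvariety` (topic `Literature/Geometry/Hyperkaehler`; wanted by the
Hodge-conjecture crux `NikulinSerreCarrier` (stmt-HodgeConjecture-14464), line `modular-twin-address`,
stub `stub_trianalyticRestriction`: Verbitsky's invariant-class criterion and the restriction of a
hyperholomorphic bundle to a trianalytic submanifold).

## Source (read: Verbitsky, *Tri-analytic subvarieties of hyperkaehler manifolds*, GAFA 5 (1995)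
92–104 = alg-geom/9403006 *Hyperkähler embeddings and holomorphic symplectic geometry II*, section
"When analytic implies tri-analytic" (§4; arXiv §3); restated in Verbitsky, *Hyperholomorphic sheaves
and new examples of hyperkähler manifolds*, alg-geom/9712012, §2.3)

* **Definition** (9403006, Introduction and §3 of the arXiv text; 9712012 §2.3): "Let `M` be a
  compact hyperkähler manifold … Let `N ⊂ M` be a closed subset of `M`. Then `N` is called
  trianalytic if `N` is a complex analytic subset of `(M, L)` for any induced complex structure `L`"
  (the induced complex structures are `L = aI + bJ + cK`, `a² + b² + c² = 1`: the tree's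
  `inducedJ J K a b c`, Huybrechts' twistor sphere, `HyperkaehlerManifold.lean`).
* **Proposition** (9403006 §3, "`N` is analytic iff `η` is constant", the key step of the paper): for
  a closed analytic subvariety `N ⊂ (M, I)` with set of non-singular points `N⁰` and an induced
  complex structure `J`, "the closed set `N ⊂ M` is analytic with respect to `J` if and only if
  `∀ x ∈ N⁰, η_J(x) = 2ⁿ`", and by Wirtinger's inequality (loc. cit., "if `η_W = 2ⁿ` then
  `I(W) = W`") `η_J(x) = 2ⁿ` iff `J(T_x N) = T_x N`; the proof of "⇐" is "Then `J(T_xN) = T_xN` …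
  Using Newlander–Nirenberg theorem, we see that `N⁰` is an analytic subset of `(M, J)` … Since the
  closure of an analytic set is also analytic, `N` is an analytic subset of `(M, J)`".
* **Theorem 4.1** (GAFA numbering, = 9712012 §2.3: "Assume that `[N] ∈ H^{2m−2n}(M)` is invariant
  with respect to the action of `SU(2)` on `H^{2m−2n}(M)`. Then `N` is trianalytic. Proof: This is
  Theorem 4.1 of [V-II]"), proved through the Proposition: `SU(2)`-invariance of `[N]` gives
  `⟨[N], ω_J^n⟩ = ⟨[N], ω_I^n⟩`, i.e. equality in Wirtinger's inequality, i.e. `J(T_xN) = T_xN` on `N⁰`.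
* 9712012 §2.3: "Trianalytic subvarieties have an action of quaternion algebra in the tangent
  bundle. In particular, the real dimension of such subvarieties is divisible by 4."

## Lean rendering

The tree's hyperkähler manifold (`HyperkaehlerManifold.lean`, `Hyperholomorphic.lean`) is a complex
manifold `M` charted on `E` with complex structure `I = tangentJ E` and two further endomorphism
fields `J, K` of the real tangent spaces (`IsHyperkaehlerTriple g J K`); the induced complex
structures `L = inducedJ J K a b c` are endomorphism fields WITHOUT a holomorphic atlas, so "complex
analytic subset of `(M, L)`" has no literal spelling for `L ≠ ±I` (it needs `L`-holomorphic
functions, i.e. the Newlander–Nirenberg theorem, to be workable — even for a point). Exactly as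
`Hyperholomorphic.lean` renders "integrable for every `L`" by Verbitsky's equivalent curvature
condition, this file renders "analytic for every `L`" by Verbitsky's equivalent TANGENT condition,
the Proposition above, on the tree's analytic-set carriers (`Literature/Geometry/Kaehler/AnalyticSet`,
`AnalyticSetRegular`):

* `IsQuaternionicAt J K x W` — the real subspace `W ⊆ T_x M` is invariant under every induced
  complex structure `L = aI + bJ + cK`, `(a, b, c) ∈ S²`; PROVED equivalent: invariance under all
  `aI + bJ + cK` (`isQuaternionicAt_iff_forall`), under all quaternions `q₀ + q₁I + q₂J + q₃K`
  (`isQuaternionicAt_iff_quaternionAct`: `W` is an `ℍ`-submodule of `T_x M`, "action of quaternion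
  algebra in the tangent bundle"), and — for a hyperkähler triple — under `I` and `J` alone
  (`IsHyperkaehlerTriple.isQuaternionicAt_iff`, as `K = IJ`).
* `IsRegularPresentation E Z x U f` — the data in the tree's `IsRegularPointOfCodim 𝓘(ℂ, E) Z p x`
  made explicit: `U ∋ x` open, `f : M → ℂᵖ` holomorphic on `U`, `Z ∩ U = U ∩ f⁻¹{0}`, `df_x` onto;
  `tangentKer E f x = ker df_x ⊆ T_x M` is then the tangent space `T_x Z` of the complex submanifold
  germ `(Z, x)` (holomorphic implicit function theorem, `RegularPointStraightening.lean`), and it does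
  NOT depend on the presentation (`IsRegularPresentation.tangentKer_eq`, from the tree's kernel
  comparison `SCV.ker_fderiv_le_ker_fderiv_of_forall_eq`).
* `HasQuaternionicTangentAt J K Z x` — for every regular presentation of `Z` at `x`, `T_x Z` is
  quaternionic (vacuous at singular points, as in the source: the condition is on `N⁰`; by
  presentation-independence it is `IsQuaternionicAt J K x (tangentKer E f x)` for any one presentation,
  `IsRegularPresentation.hasQuaternionicTangentAt_iff`).
* `IsTrianalytic J K Z` — **`Z` is a closed analytic subset of `(M, I)` (`IsAnalyticSet 𝓘(ℂ, E) Z`,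
  closedness is then a theorem) whose tangent space at every regular point is invariant under every
  induced complex structure.** Since `T_x Z = ker df_x` is automatically `I`-invariant (`df_x` is
  `ℂ`-linear, `tangentJ_mem_tangentKer`), for a hyperkähler triple this is `J`-invariance of the
  tangent spaces alone (`IsHyperkaehlerTriple.isTrianalytic_iff`), Verbitsky's "`J(T_xN) = T_xN`
  for all `x ∈ N⁰`".

The hyperkähler structure enters only through `J, K` (explicit arguments, as in
`IsHyperkaehlerTriple g J K` and `IsSU2InvariantAt J K`); the metric plays no role in the definition
and compactness is not built in (consumers add `[CompactSpace M]`, `IsHyperkaehlerTriple g J K`).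

## The restriction lemma (proved, pointwise and for forms)

`IsSU2InvariantAt.comp_of_semiconj`: if a `2`-covector `β` on `T_x M` is `SU(2)`-invariant
(`Hyperholomorphic.lean`: of type `(1,1)` for every induced complex structure — the curvature
condition of hyperholomorphic connections) and `φ : T_y S → T_x M` is a real-linear map from the
tangent space of a second almost-hypercomplex charted space `(S, I', J', K')` intertwining the
structures (`φ ∘ I' = I ∘ φ`, `φ ∘ J' = J ∘ φ`, `φ ∘ K' = K ∘ φ` — the differential of a
"hypercomplex" immersion, e.g. the inclusion of a trianalytic submanifold with its induced triple),
then `φ^*β` is `SU(2)`-invariant on `T_y S`; the image of such a `φ` is a quaternionic subspace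
(`isQuaternionicAt_range_of_semiconj`), and for `2`-forms `IsSU2InvariantOn.pullback`: the pull-back
(`MForm.pullback`) of a form `SU(2)`-invariant on `U` along a map whose differential intertwines the
structures over `U` is `SU(2)`-invariant on the preimage of `U`. This is the pointwise content of
"a hyperholomorphic bundle restricted to a trianalytic subvariety is hyperholomorphic".

## Non-vacuity (proved)

`∅`, the whole manifold, and one-point sets are trianalytic (`isTrianalytic_empty`,
`isTrianalytic_univ`, `isTrianalytic_singleton` — the last one computes `T_x{x} = 0` from the
uniqueness of the codimension at a regular point); `⊤`, `⊥`, intersections and images of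
intertwining maps are quaternionic subspaces, while a real line `ℝv`, `v ≠ 0`, is not
(`not_isQuaternionicAt_span_singleton`), so the predicate is a genuine restriction.

## What is NOT here (theorems about the notion, to be vendored as cited facts against it)

* The equivalence of this rendering with the literal wording "analytic subset of `(M, L)` for every
  `L`" (Verbitsky's Proposition: Wirtinger + Newlander–Nirenberg for the integrable `L` + extension
  of the analytic set `N⁰` across `Sing N`); in particular closure of trianalytic sets under finite
  unions and intersections, trivial for the literal wording, is not proved for this one.
* Theorem 4.1 (`[N]` `SU(2)`-invariant ⇒ `N` trianalytic) and its numerical form for surfaces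
  (`∫_N ω_I² = ∫_N ω_J²` ⇒ `J(T_xN) = T_xN` on `N⁰`): they need the fundamental class / the current
  of integration of a closed analytic subvariety of a compact manifold in cohomology, which the tree
  has only in the model space (`HolomorphicChain`, `WirtingerAreaFormula.lean`).
* Trianalytic subvarieties are (singular) hyperkähler varieties; Verbitsky's desingularisation
  theorem; deformations of trianalytic subvarieties; `dim_ℝ` divisible by `4`.
* Restriction of the tree's bundle-with-connection carriers (`HermitianHolomorphicBundle`, …) to a
  submanifold: only the curvature-level (form-level) statement is given.

## References

* [Verbitsky1995Trianalytic] M. Verbitsky, Tri-analytic subvarieties of hyperkaehler manifolds,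
  GAFA 5 (1995) no. 1, 92–104, doi:10.1007/bf01928217 = alg-geom/9403006 ("Hyperkähler embeddings and
  holomorphic symplectic geometry II"): Introduction (definition of tri-analytic subsets) and the
  section "When analytic implies tri-analytic" (§4 of the journal version, whose main theorem is cited
  as "Theorem 4.1" in [Verbitsky1997HyperholomorphicSheaves]; §3 of the arXiv text, read): Definition,
  Theorem, Wirtinger Proposition, Proposition "`N` is analytic iff `η` is constant".
* [Verbitsky1997HyperholomorphicSheaves] M. Verbitsky, Hyperholomorphic sheaves and new examples of
  hyperkähler manifolds, alg-geom/9712012, §2.3 (Definition, Theorem "= Thm. 4.1 of [V-II]",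
  quaternion action on the tangent bundle) (read).
* [Verbitsky1996Hyperholomorphic] M. Verbitsky, Hyperholomorphic bundles over a hyperkähler manifold,
  alg-geom/9307008, §1 (induced complex structures, the `SU(2)`-action).
* [Chirka1989] E. M. Chirka, Complex Analytic Sets, §2.3 (regular points, tangent spaces).
-/

noncomputable section

open scoped Manifold ContDiff Topology
open Bundle Set

namespace Literature.Geometry.Hyperkaehler

open Literature.Geometry.Kaehler

variable {E : Type*} [NormedAddCommGroup E] [NormedSpace ℂ E]
  {M : Type*} [TopologicalSpace M] [ChartedSpace E M]

/-! ### Quaternionic subspaces of a tangent space -/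

/-- **The real subspace `W ⊆ T_x M` is quaternionic** (an `ℍ`-submodule of the tangent space of the
hyperkähler manifold `(M, I = tangentJ E, J, K)` at `x`): `W` is invariant under every induced
complex structure `L = aI + bJ + cK`, `(a, b, c) ∈ S²` — `L(W) ⊆ W`, hence `L(W) = W` as `L² = −1`.
Equivalently (proved below) `W` is invariant under all quaternions `q₀ + q₁I + q₂J + q₃K`
(`isQuaternionicAt_iff_quaternionAct`), or under `I` and `J` (`IsHyperkaehlerTriple.isQuaternionicAt_iff`).
This is the condition "`J(T_x N) = T_x N`" / "action of quaternion algebra in the tangent bundle" on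
the tangent spaces of a trianalytic subvariety.
[cite: Verbitsky1995Trianalytic, §4 Prop. (N is analytic iff eta is constant) (arXiv §3)] -/
def IsQuaternionicAt (J K : ∀ x : M, TangentSpace 𝓘(ℝ, E) x →L[ℝ] TangentSpace 𝓘(ℝ, E) x) (x : M)
    (W : Submodule ℝ (TangentSpace 𝓘(ℝ, E) x)) : Prop :=
  ∀ a b c : ℝ, a ^ 2 + b ^ 2 + c ^ 2 = 1 → ∀ v ∈ W, inducedJ J K a b c x v ∈ W

section Quaternionic

variable {J K : ∀ x : M, TangentSpace 𝓘(ℝ, E) x →L[ℝ] TangentSpace 𝓘(ℝ, E) x} {x : M}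

/-- The whole tangent space is quaternionic. [folklore] -/
theorem isQuaternionicAt_top (J K : ∀ x : M, TangentSpace 𝓘(ℝ, E) x →L[ℝ] TangentSpace 𝓘(ℝ, E) x)
    (x : M) : IsQuaternionicAt J K x ⊤ :=
  fun _ _ _ _ _ _ ↦ Submodule.mem_top

/-- The zero subspace is quaternionic. [folklore] -/
theorem isQuaternionicAt_bot (J K : ∀ x : M, TangentSpace 𝓘(ℝ, E) x →L[ℝ] TangentSpace 𝓘(ℝ, E) x)
    (x : M) : IsQuaternionicAt J K x ⊥ := fun a b c _ v hv ↦ by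
  rw [Submodule.mem_bot] at hv ⊢
  rw [hv, map_zero]

/-- Quaternionic subspaces are stable under intersection. [folklore] -/
theorem IsQuaternionicAt.inf {W W' : Submodule ℝ (TangentSpace 𝓘(ℝ, E) x)}
    (hW : IsQuaternionicAt J K x W) (hW' : IsQuaternionicAt J K x W') :
    IsQuaternionicAt J K x (W ⊓ W') :=
  fun a b c habc v hv ↦ ⟨hW a b c habc v hv.1, hW' a b c habc v hv.2⟩

/-- A quaternionic subspace is invariant under `aI + bJ + cK` for EVERY `(a, b, c) ∈ ℝ³` (rescale to
the unit sphere; `W` is a subspace). [folklore] -/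
theorem isQuaternionicAt_iff_forall {W : Submodule ℝ (TangentSpace 𝓘(ℝ, E) x)} :
    IsQuaternionicAt J K x W ↔ ∀ a b c : ℝ, ∀ v ∈ W, inducedJ J K a b c x v ∈ W := by
  refine ⟨fun h a b c v hv ↦ ?_, fun h a b c _ ↦ h a b c⟩
  obtain hr | hr := eq_or_ne (a ^ 2 + b ^ 2 + c ^ 2) 0
  · have ha : a = 0 := by nlinarith [sq_nonneg a, sq_nonneg b, sq_nonneg c]
    have hb : b = 0 := by nlinarith [sq_nonneg a, sq_nonneg b, sq_nonneg c]
    have hc : c = 0 := by nlinarith [sq_nonneg a, sq_nonneg b, sq_nonneg c]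
    simp only [ha, hb, hc, inducedJ_apply, zero_smul, add_zero]
    exact W.zero_mem
  · set r := Real.sqrt (a ^ 2 + b ^ 2 + c ^ 2) with hr_def
    have hr0 : 0 < r := Real.sqrt_pos.2 ((add_nonneg (add_nonneg (sq_nonneg a) (sq_nonneg b))
      (sq_nonneg c)).lt_of_ne' hr)
    have hrr : r ^ 2 = a ^ 2 + b ^ 2 + c ^ 2 :=
      Real.sq_sqrt (add_nonneg (add_nonneg (sq_nonneg a) (sq_nonneg b)) (sq_nonneg c))
    have hrne : r ≠ 0 := hr0.ne'
    have hunit : (a / r) ^ 2 + (b / r) ^ 2 + (c / r) ^ 2 = 1 := by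
      field_simp
      linarith
    have e1 : r * (a / r) = a := by field_simp
    have e2 : r * (b / r) = b := by field_simp
    have e3 : r * (c / r) = c := by field_simp
    have key : inducedJ J K a b c x v = r • inducedJ J K (a / r) (b / r) (c / r) x v := by
      simp only [inducedJ_apply, smul_add, smul_smul, e1, e2, e3]
    rw [key]
    exact W.smul_mem r (h _ _ _ hunit v hv)

namespace IsQuaternionicAt

variable {W : Submodule ℝ (TangentSpace 𝓘(ℝ, E) x)}

/-- A quaternionic subspace is invariant under every `aI + bJ + cK`. [folklore] -/
theorem inducedJ_mem (hW : IsQuaternionicAt J K x W) (a b c : ℝ) {v : TangentSpace 𝓘(ℝ, E) x}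
    (hv : v ∈ W) : inducedJ J K a b c x v ∈ W :=
  isQuaternionicAt_iff_forall.1 hW a b c v hv

/-- A quaternionic subspace is a complex subspace for `I`: `I(W) ⊆ W`.
[cite: Verbitsky1995Trianalytic, §4 (arXiv §3)] -/
theorem tangentJ_mem (hW : IsQuaternionicAt J K x W) {v : TangentSpace 𝓘(ℝ, E) x} (hv : v ∈ W) :
    tangentJ E x v ∈ W := by
  simpa [inducedJ_apply] using hW 1 0 0 (by norm_num) v hv

/-- A quaternionic subspace is `J`-invariant: `J(W) ⊆ W` ("`J(T_xN) = T_xN`").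
[cite: Verbitsky1995Trianalytic, §4 (arXiv §3)] -/
theorem J_mem (hW : IsQuaternionicAt J K x W) {v : TangentSpace 𝓘(ℝ, E) x} (hv : v ∈ W) :
    J x v ∈ W := by
  simpa [inducedJ_apply] using hW 0 1 0 (by norm_num) v hv

/-- A quaternionic subspace is `K`-invariant: `K(W) ⊆ W`.
[cite: Verbitsky1995Trianalytic, §4 (arXiv §3)] -/
theorem K_mem (hW : IsQuaternionicAt J K x W) {v : TangentSpace 𝓘(ℝ, E) x} (hv : v ∈ W) :
    K x v ∈ W := by
  simpa [inducedJ_apply] using hW 0 0 1 (by norm_num) v hv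

/-- A quaternionic subspace is an `ℍ`-submodule: invariant under every quaternion
`q = q₀ + q₁I + q₂J + q₃K` acting on `T_x M` (`quaternionAct`).
[cite: Verbitsky1997HyperholomorphicSheaves, §2.3 ("action of quaternion algebra in the tangent bundle")] -/
theorem quaternionAct_mem (hW : IsQuaternionicAt J K x W) (q₀ q₁ q₂ q₃ : ℝ)
    {v : TangentSpace 𝓘(ℝ, E) x} (hv : v ∈ W) : quaternionAct J K q₀ q₁ q₂ q₃ x v ∈ W := by
  rw [quaternionAct_apply]
  exact W.add_mem (W.add_mem (W.add_mem (W.smul_mem _ hv) (W.smul_mem _ (hW.tangentJ_mem hv)))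
    (W.smul_mem _ (hW.J_mem hv))) (W.smul_mem _ (hW.K_mem hv))

end IsQuaternionicAt

/-- **Quaternionic = `ℍ`-submodule**: `W` is quaternionic iff it is invariant under the action of
every quaternion `q₀ + q₁I + q₂J + q₃K` on `T_x M`.
[cite: Verbitsky1997HyperholomorphicSheaves, §2.3 ("action of quaternion algebra in the tangent bundle")] -/
theorem isQuaternionicAt_iff_quaternionAct {W : Submodule ℝ (TangentSpace 𝓘(ℝ, E) x)} :
    IsQuaternionicAt J K x W ↔
      ∀ q₀ q₁ q₂ q₃ : ℝ, ∀ v ∈ W, quaternionAct J K q₀ q₁ q₂ q₃ x v ∈ W :=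
  ⟨fun hW q₀ q₁ q₂ q₃ _ hv ↦ hW.quaternionAct_mem q₀ q₁ q₂ q₃ hv, fun h a b c _ v hv ↦ by
    simpa only [quaternionAct_zero] using h 0 a b c v hv⟩

/-- **A real line is not quaternionic**: for `v ≠ 0` the span `ℝv` is not invariant under `I`
(`Iv = t v` would give `−v = t² v`), so the predicate is a genuine restriction (quaternionic subspaces
have real dimension divisible by `4`). [folklore] -/
theorem not_isQuaternionicAt_span_singleton {v : TangentSpace 𝓘(ℝ, E) x} (hv : v ≠ 0) :
    ¬ IsQuaternionicAt J K x (Submodule.span ℝ {v}) := by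
  intro hW
  have hI := hW.tangentJ_mem (Submodule.mem_span_singleton_self v)
  rw [Submodule.mem_span_singleton] at hI
  obtain ⟨t, ht⟩ := hI
  have h2 : (t * t) • v = -v := by
    rw [← tangentJ_tangentJ x v, ← ht, map_smul, ← ht, smul_smul]
  have h3 : (t * t + 1) • v = 0 := by rw [add_smul, one_smul, h2, neg_add_cancel]
  rw [smul_eq_zero] at h3
  rcases h3 with h3 | h3
  · nlinarith [mul_self_nonneg t]
  · exact hv h3

namespace IsHyperkaehlerTriple

variable {g : RiemannianMetric (fun x : M ↦ TangentSpace 𝓘(ℝ, E) x)}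

/-- **For a hyperkähler triple, quaternionic = invariant under `I` and `J`** (`K = IJ`, and
`aI + bJ + cK` is a combination). [cite: Verbitsky1995Trianalytic, §4 (arXiv §3)] -/
theorem isQuaternionicAt_iff (h : IsHyperkaehlerTriple g J K) (x : M)
    (W : Submodule ℝ (TangentSpace 𝓘(ℝ, E) x)) :
    IsQuaternionicAt J K x W ↔
      (∀ v ∈ W, tangentJ E x v ∈ W) ∧ ∀ v ∈ W, J x v ∈ W := by
  refine ⟨fun hW ↦ ⟨fun v hv ↦ hW.tangentJ_mem hv, fun v hv ↦ hW.J_mem hv⟩,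
    fun ⟨hI, hJ⟩ a b c _ v hv ↦ ?_⟩
  have hK : K x v ∈ W := by
    rw [← h.I_J]
    exact hI _ (hJ v hv)
  rw [inducedJ_apply]
  exact W.add_mem (W.add_mem (W.smul_mem a (hI v hv)) (W.smul_mem b (hJ v hv))) (W.smul_mem c hK)

/-- For a hyperkähler triple, a subspace invariant under `I` and `J` is quaternionic.
[cite: Verbitsky1995Trianalytic, §4 (arXiv §3)] -/
theorem isQuaternionicAt_of_tangentJ_mem_of_J_mem (h : IsHyperkaehlerTriple g J K) (x : M)
    {W : Submodule ℝ (TangentSpace 𝓘(ℝ, E) x)} (hI : ∀ v ∈ W, tangentJ E x v ∈ W)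
    (hJ : ∀ v ∈ W, J x v ∈ W) : IsQuaternionicAt J K x W :=
  (h.isQuaternionicAt_iff x W).2 ⟨hI, hJ⟩

end IsHyperkaehlerTriple

end Quaternionic

/-! ### Restriction of `SU(2)`-invariant covectors along intertwining maps -/

section Restriction

variable {E' : Type*} [NormedAddCommGroup E'] [NormedSpace ℂ E']
  {S : Type*} [TopologicalSpace S] [ChartedSpace E' S]
  {V : Type*} [NormedAddCommGroup V] [NormedSpace ℝ V]
  {J K : ∀ x : M, TangentSpace 𝓘(ℝ, E) x →L[ℝ] TangentSpace 𝓘(ℝ, E) x}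
  {J' K' : ∀ y : S, TangentSpace 𝓘(ℝ, E') y →L[ℝ] TangentSpace 𝓘(ℝ, E') y}
  {x : M} {y : S}

/-- Pull-back of a `2`-covector by a linear map between two spaces, in the `![v, w]` format:
`(φ^*β)(v, w) = β(φ v, φ w)` (the tree's `compContinuousLinearMap_apply₂` is the endomorphism case).
[folklore] -/
theorem compContinuousLinearMap_apply₂' {T T' : Type*} [AddCommGroup T] [Module ℝ T]
    [TopologicalSpace T] [AddCommGroup T'] [Module ℝ T'] [TopologicalSpace T']
    (β : T [⋀^Fin 2]→L[ℝ] V) (φ : T' →L[ℝ] T) (v w : T') :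
    β.compContinuousLinearMap φ ![v, w] = β ![φ v, φ w] := by
  rw [ContinuousAlternatingMap.compContinuousLinearMap_apply]
  congr 1
  funext i
  fin_cases i <;> rfl

/-- A real-linear map `φ : T_y S → T_x M` intertwining `I', J', K'` with `I, J, K` intertwines every
induced complex structure: `φ ∘ (aI' + bJ' + cK') = (aI + bJ + cK) ∘ φ`. [folklore] -/
theorem inducedJ_semiconj (φ : TangentSpace 𝓘(ℝ, E') y →L[ℝ] TangentSpace 𝓘(ℝ, E) x)
    (hI : ∀ v, φ (tangentJ E' y v) = tangentJ E x (φ v))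
    (hJ : ∀ v, φ (J' y v) = J x (φ v)) (hK : ∀ v, φ (K' y v) = K x (φ v)) (a b c : ℝ)
    (v : TangentSpace 𝓘(ℝ, E') y) :
    φ (inducedJ J' K' a b c y v) = inducedJ J K a b c x (φ v) := by
  simp only [inducedJ_apply, map_add, map_smul, hI, hJ, hK]

/-- **Restriction lemma (pointwise).** If the `2`-covector `β` on `T_x M` is `SU(2)`-invariant (of
type `(1,1)` for every induced complex structure of `(M, I, J, K)`) and `φ : T_y S → T_x M` is a
real-linear map intertwining the structures `(I', J', K')` of `S` at `y` with `(I, J, K)` — e.g. the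
differential of the inclusion of a trianalytic submanifold carrying the induced triple — then the
pulled-back covector `φ^*β = β(φ ·, φ ·)` is `SU(2)`-invariant on `T_y S`. This is the pointwise
content of "the restriction of a hyperholomorphic connection to a trianalytic subvariety is
hyperholomorphic" (the curvature of the restricted connection is the restriction of the curvature).
[cite: Verbitsky1996Hyperholomorphic, Def. 2.1] -/
theorem IsSU2InvariantAt.comp_of_semiconj {β : TangentSpace 𝓘(ℝ, E) x [⋀^Fin 2]→L[ℝ] V}
    (hβ : IsSU2InvariantAt J K x β) (φ : TangentSpace 𝓘(ℝ, E') y →L[ℝ] TangentSpace 𝓘(ℝ, E) x)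
    (hI : ∀ v, φ (tangentJ E' y v) = tangentJ E x (φ v))
    (hJ : ∀ v, φ (J' y v) = J x (φ v)) (hK : ∀ v, φ (K' y v) = K x (φ v)) :
    IsSU2InvariantAt J' K' y (β.compContinuousLinearMap φ) := fun a b c habc v w ↦ by
  rw [compContinuousLinearMap_apply₂', compContinuousLinearMap_apply₂',
    inducedJ_semiconj φ hI hJ hK, inducedJ_semiconj φ hI hJ hK, hβ a b c habc]

/-- The image of an intertwining map `φ : T_y S → T_x M` (e.g. the tangent space of a hypercomplex
immersed submanifold) is a quaternionic subspace of `T_x M`. [folklore] -/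
theorem isQuaternionicAt_range_of_semiconj
    (φ : TangentSpace 𝓘(ℝ, E') y →L[ℝ] TangentSpace 𝓘(ℝ, E) x)
    (hI : ∀ v, φ (tangentJ E' y v) = tangentJ E x (φ v))
    (hJ : ∀ v, φ (J' y v) = J x (φ v)) (hK : ∀ v, φ (K' y v) = K x (φ v)) :
    IsQuaternionicAt J K x (LinearMap.range φ.toLinearMap) := by
  rintro a b c - _ ⟨v, rfl⟩
  exact ⟨inducedJ J' K' a b c y v, inducedJ_semiconj φ hI hJ hK a b c v⟩

/-- **Restriction lemma (forms).** Let `β` be a `V`-valued `2`-form on `M`, `SU(2)`-invariant on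
`U ⊆ M` (e.g. a curvature form of a hyperholomorphic connection on a frame domain `U`), and
`φ : S → M` a map whose differential at every point of `φ⁻¹ U` intertwines `(I', J', K')` with
`(I, J, K)` (a hypercomplex map, e.g. the inclusion of a trianalytic submanifold with its induced
triple). Then the pull-back `φ^*β` is `SU(2)`-invariant on `φ⁻¹ U`.
[cite: Verbitsky1996Hyperholomorphic, Def. 2.1] -/
theorem IsSU2InvariantOn.pullback {β : MForm 𝓘(ℝ, E) M V 2} {U : Set M}
    (hβ : IsSU2InvariantOn J K β U) {φ : S → M}
    (hI : ∀ y ∈ φ ⁻¹' U, ∀ v, mfderiv 𝓘(ℝ, E') 𝓘(ℝ, E) φ y (tangentJ E' y v) =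
      tangentJ E (φ y) (mfderiv 𝓘(ℝ, E') 𝓘(ℝ, E) φ y v))
    (hJ : ∀ y ∈ φ ⁻¹' U, ∀ v, mfderiv 𝓘(ℝ, E') 𝓘(ℝ, E) φ y (J' y v) =
      J (φ y) (mfderiv 𝓘(ℝ, E') 𝓘(ℝ, E) φ y v))
    (hK : ∀ y ∈ φ ⁻¹' U, ∀ v, mfderiv 𝓘(ℝ, E') 𝓘(ℝ, E) φ y (K' y v) =
      K (φ y) (mfderiv 𝓘(ℝ, E') 𝓘(ℝ, E) φ y v)) :
    IsSU2InvariantOn J' K' (β.pullback 𝓘(ℝ, E') φ) (φ ⁻¹' U) :=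
  fun y hy ↦ (hβ (φ y) hy).comp_of_semiconj (mfderiv 𝓘(ℝ, E') 𝓘(ℝ, E) φ y) (hI y hy) (hJ y hy)
    (hK y hy)

end Restriction

/-! ### Tangent spaces of analytic sets at regular points -/

section Tangent

variable {p : ℕ}

variable (E) in
/-- The kernel `ker df_x ⊆ T_x M` of the (complex-linear) differential at `x` of a map
`f : M → ℂᵖ`, as a REAL subspace of the real tangent space `T_x M = E` (for a regular presentation
`f` of an analytic set `Z` at `x` this is the tangent space `T_x Z`, Chirka §2.3).
[cite: Chirka1989, §2.3] -/
def tangentKer (f : M → (Fin p → ℂ)) (x : M) : Submodule ℝ (TangentSpace 𝓘(ℝ, E) x) :=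
  show Submodule ℝ E from
    (LinearMap.ker
      (show E →L[ℂ] (Fin p → ℂ) from mfderiv 𝓘(ℂ, E) 𝓘(ℂ, Fin p → ℂ) f x).toLinearMap).restrictScalars ℝ

/-- `v ∈ ker df_x ↔ df_x v = 0`. [cite: Chirka1989, §2.3] -/
theorem mem_tangentKer (f : M → (Fin p → ℂ)) (x : M) (v : TangentSpace 𝓘(ℝ, E) x) :
    v ∈ tangentKer E f x ↔ mfderiv 𝓘(ℂ, E) 𝓘(ℂ, Fin p → ℂ) f x v = 0 :=
  Iff.rfl

/-- The complex differential is `ℂ`-linear, in the language of the real tangent space: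
`df_x (Iv) = i · df_x v`. [folklore] -/
theorem mfderiv_tangentJ {F' : Type*} [NormedAddCommGroup F'] [NormedSpace ℂ F'] (f : M → F')
    (x : M) (v : TangentSpace 𝓘(ℝ, E) x) :
    mfderiv 𝓘(ℂ, E) 𝓘(ℂ, F') f x (tangentJ E x v) =
      Complex.I • mfderiv 𝓘(ℂ, E) 𝓘(ℂ, F') f x v :=
  (mfderiv 𝓘(ℂ, E) 𝓘(ℂ, F') f x).map_smul Complex.I v

/-- `ker df_x` is a complex subspace: invariant under `I = tangentJ E`. [cite: Chirka1989, §2.3] -/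
theorem tangentJ_mem_tangentKer {f : M → (Fin p → ℂ)} {x : M} {v : TangentSpace 𝓘(ℝ, E) x}
    (hv : v ∈ tangentKer E f x) : tangentJ E x v ∈ tangentKer E f x := by
  rw [mem_tangentKer] at hv ⊢
  rw [mfderiv_tangentJ, hv, smul_zero]

/-- If `df_x = 0` then `ker df_x` is everything. [folklore] -/
theorem tangentKer_eq_top {f : M → (Fin p → ℂ)} {x : M}
    (h : mfderiv 𝓘(ℂ, E) 𝓘(ℂ, Fin p → ℂ) f x = 0) : tangentKer E f x = ⊤ := by
  rw [eq_top_iff]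
  intro v _
  rw [mem_tangentKer, h]
  rfl

variable (E) in
/-- **Regular presentation of `Z` at `x` (codimension `p`)**: the data of the tree's
`IsRegularPointOfCodim 𝓘(ℂ, E) Z p x` — an open `U ∋ x`, a map `f : M → ℂᵖ` holomorphic on `U` with
`Z ∩ U = U ∩ f⁻¹{0}` and onto differential at `x` (so that `Z` is a complex submanifold of
codimension `p` near `x` with tangent space `ker df_x`, by the holomorphic implicit function theorem).
Membership `x ∈ Z` is not part of the predicate (as for `IsRegularPointOfCodim`).
[cite: Chirka1989, §2.3] -/
structure IsRegularPresentation (Z : Set M) (x : M) (U : Set M) (f : M → (Fin p → ℂ)) : Prop where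
  /-- `U` is open … -/
  isOpen : IsOpen U
  /-- … and contains `x`. -/
  mem : x ∈ U
  /-- `f` is holomorphic on `U`. -/
  mdifferentiableOn : MDifferentiableOn 𝓘(ℂ, E) 𝓘(ℂ, Fin p → ℂ) f U
  /-- `Z` is cut out by `f` on `U`. -/
  inter_eq : Z ∩ U = U ∩ f ⁻¹' {0}
  /-- The differential of `f` at `x` is onto. -/
  surjective : Function.Surjective (mfderiv 𝓘(ℂ, E) 𝓘(ℂ, Fin p → ℂ) f x)

/-- A regular presentation of codimension `p` at `x` witnesses `IsRegularPointOfCodim 𝓘(ℂ, E) Z p x`.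
[cite: Chirka1989, §2.3] -/
theorem IsRegularPresentation.isRegularPointOfCodim {Z U : Set M} {x : M} {f : M → (Fin p → ℂ)}
    (h : IsRegularPresentation E Z x U f) : IsRegularPointOfCodim 𝓘(ℂ, E) Z p x :=
  ⟨U, h.isOpen, h.mem, f, h.mdifferentiableOn, h.inter_eq, h.surjective⟩

/-- `x` is regular of codimension `p` iff `Z` has a regular presentation of codimension `p` at `x`
(unfolding). [cite: Chirka1989, §2.3] -/
theorem isRegularPointOfCodim_iff_exists_isRegularPresentation {Z : Set M} {x : M} :
    IsRegularPointOfCodim 𝓘(ℂ, E) Z p x ↔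
      ∃ (U : Set M) (f : M → (Fin p → ℂ)), IsRegularPresentation E Z x U f :=
  ⟨fun ⟨U, hU, hxU, f, hf, hZU, hs⟩ ↦ ⟨U, f, ⟨hU, hxU, hf, hZU, hs⟩⟩,
    fun ⟨_, _, h⟩ ↦ h.isRegularPointOfCodim⟩

/-- A point of `Z` with a regular presentation is a regular point of `Z`. [cite: Chirka1989, §2.3] -/
theorem IsRegularPresentation.mem_regularLocus {Z U : Set M} {x : M} {f : M → (Fin p → ℂ)}
    (h : IsRegularPresentation E Z x U f) (hx : x ∈ Z) : x ∈ regularLocus 𝓘(ℂ, E) Z :=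
  ⟨hx, p, h.isRegularPointOfCodim⟩

/-- `f` vanishes at the points of `Z ∩ U`. [cite: Chirka1989, §2.3] -/
theorem IsRegularPresentation.apply_eq_zero {Z U : Set M} {x : M} {f : M → (Fin p → ℂ)}
    (h : IsRegularPresentation E Z x U f) {z : M} (hz : z ∈ Z) (hzU : z ∈ U) : f z = 0 :=
  (h.inter_eq.subset ⟨hz, hzU⟩).2

end Tangent

/-! ### Presentation independence of the tangent space -/

section Independence

variable [FiniteDimensional ℂ E] [IsManifold 𝓘(ℂ, E) 1 M] {p q : ℕ}

/-- **Kernel comparison for two presentations** (manifold form of the tree's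
`SCV.ker_fderiv_le_ker_fderiv_of_forall_eq`): if `f` presents `Z` regularly at `x ∈ Z` on `U` and
`g : M → ℂ^q` is holomorphic on an open `U' ∋ x` and vanishes on `Z ∩ U'`, then `ker df_x ≤ ker dg_x`
(in the chart at `x`, `g` is constant on the fibre of `f` through `x`, which is the image of `Z`).
[cite: Chirka1989, §2.3] -/
theorem IsRegularPresentation.tangentKer_le {Z U U' : Set M} {x : M} {f : M → (Fin p → ℂ)}
    {g : M → (Fin q → ℂ)} (hx : x ∈ Z) (hf : IsRegularPresentation E Z x U f) (hU' : IsOpen U')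
    (hxU' : x ∈ U') (hg : MDifferentiableOn 𝓘(ℂ, E) 𝓘(ℂ, Fin q → ℂ) g U')
    (hgZ : ∀ z ∈ Z ∩ U', g z = 0) : tangentKer E f x ≤ tangentKer E g x := by
  set φ := extChartAt 𝓘(ℂ, E) x with hφ
  set W := φ.target ∩ φ.symm ⁻¹' (U ∩ U') with hW
  have hWo : IsOpen W := isOpen_extChartAt_target_inter_preimage_symm x (hf.isOpen.inter hU')
  have haW : φ x ∈ W :=
    ⟨mem_extChartAt_target x, by
      simpa only [hφ, mem_preimage, extChartAt_to_inv] using ⟨hf.mem, hxU'⟩⟩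
  have hF : DifferentiableOn ℂ (f ∘ φ.symm) W :=
    (MDifferentiableOn.differentiableOn_extChartAt_symm hf.mdifferentiableOn x).mono
      (inter_subset_inter_right _ (preimage_mono inter_subset_left))
  have hG : DifferentiableOn ℂ (g ∘ φ.symm) W :=
    (MDifferentiableOn.differentiableOn_extChartAt_symm hg x).mono
      (inter_subset_inter_right _ (preimage_mono inter_subset_right))
  have hFa : DifferentiableAt ℂ (f ∘ φ.symm) (φ x) := hF.differentiableAt (hWo.mem_nhds haW)
  have hGa : DifferentiableAt ℂ (g ∘ φ.symm) (φ x) := hG.differentiableAt (hWo.mem_nhds haW)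
  have hFs : Function.Surjective (fderiv ℂ (f ∘ φ.symm) (φ x)) :=
    (surjective_mfderiv_iff_extChartAt (mem_extChartAt_source x) hFa).1 hf.surjective
  have hfx : f x = 0 := hf.apply_eq_zero hx hf.mem
  have hgx : g x = 0 := hgZ x ⟨hx, hxU'⟩
  have hfib : ∀ z ∈ W, (f ∘ φ.symm) z = (f ∘ φ.symm) (φ x) → (g ∘ φ.symm) z = (g ∘ φ.symm) (φ x) := by
    intro z hz h0
    simp only [Function.comp_apply, hφ, extChartAt_to_inv, hfx, hgx] at h0 ⊢
    have hzU : φ.symm z ∈ U := hz.2.1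
    have hzU' : φ.symm z ∈ U' := hz.2.2
    have hzZ : φ.symm z ∈ Z := (hf.inter_eq.symm.subset ⟨hzU, h0⟩).1
    exact hgZ _ ⟨hzZ, hzU'⟩
  have hker := SCV.ker_fderiv_le_ker_fderiv_of_forall_eq hF hG hWo haW hFs hfib
  -- transport along the (invertible) differential of the chart
  intro v hv
  rw [mem_tangentKer] at hv ⊢
  have ef := mfderiv_eq_fderiv_comp_mfderiv_extChartAt (I := 𝓘(ℂ, E)) (f := f)
    (mem_extChartAt_source x) hFa
  have eg := mfderiv_eq_fderiv_comp_mfderiv_extChartAt (I := 𝓘(ℂ, E)) (f := g)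
    (mem_extChartAt_source x) hGa
  have hv' : fderiv ℂ (f ∘ φ.symm) (φ x) (mfderiv 𝓘(ℂ, E) 𝓘(ℂ, E) φ x v) = 0 := by
    rw [ef] at hv
    exact hv
  have hw : fderiv ℂ (g ∘ φ.symm) (φ x) (mfderiv 𝓘(ℂ, E) 𝓘(ℂ, E) φ x v) = 0 :=
    LinearMap.mem_ker.1 (hker (LinearMap.mem_ker.2 hv'))
  rw [eg]
  exact hw

/-- **The tangent space at a regular point does not depend on the presentation**: two regular
presentations of `Z` at `x ∈ Z` have the same `ker df_x` (and the same codimension,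
`IsRegularPointOfCodim.codim_unique`). [cite: Chirka1989, §2.3] -/
theorem IsRegularPresentation.tangentKer_eq {Z U U' : Set M} {x : M} {f : M → (Fin p → ℂ)}
    {g : M → (Fin q → ℂ)} (hx : x ∈ Z) (hf : IsRegularPresentation E Z x U f)
    (hg : IsRegularPresentation E Z x U' g) : tangentKer E f x = tangentKer E g x :=
  le_antisymm
    (hf.tangentKer_le hx hg.isOpen hg.mem hg.mdifferentiableOn fun _ hz ↦ hg.apply_eq_zero hz.1 hz.2)
    (hg.tangentKer_le hx hf.isOpen hf.mem hf.mdifferentiableOn fun _ hz ↦ hf.apply_eq_zero hz.1 hz.2)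

/-- **A point is a regular point of `{x}` of codimension `dim E`**, presented on the chart domain
at `x` by `e ↦ L(φ e − φ x)` for the extended chart `φ` and a linear isomorphism `L : E ≃ ℂ^{dim E}`
(the presentation used in the tree's `isAnalyticSetAt_singleton_self`, with its differential
`L ∘ dφ_x` onto). [folklore] -/
theorem exists_isRegularPresentation_singleton (x : M) :
    ∃ f : M → (Fin (Module.finrank ℂ E) → ℂ),
      IsRegularPresentation E ({x} : Set M) x (chartAt E x).source f := by
  set L : E ≃L[ℂ] (Fin (Module.finrank ℂ E) → ℂ) :=
    ContinuousLinearEquiv.ofFinrankEq (Module.finrank_fin_fun ℂ).symm with hL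
  set g : E → (Fin (Module.finrank ℂ E) → ℂ) := fun e ↦ L (e - extChartAt 𝓘(ℂ, E) x x) with hg
  have hgd : Differentiable ℂ g :=
    (L : E →L[ℂ] (Fin (Module.finrank ℂ E) → ℂ)).differentiable.comp
      (differentiable_id.sub_const (extChartAt 𝓘(ℂ, E) x x))
  have hs : (chartAt E x).source ⊆ (extChartAt 𝓘(ℂ, E) x).source := by rw [extChartAt_source]
  refine ⟨g ∘ extChartAt 𝓘(ℂ, E) x, (chartAt E x).open_source, mem_chart_source E x, ?_, ?_, ?_⟩
  · have h2s : MapsTo (g ∘ extChartAt 𝓘(ℂ, E) x) (chartAt E x).source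
        (extChartAt 𝓘(ℂ, Fin (Module.finrank ℂ E) → ℂ)
          (g (extChartAt 𝓘(ℂ, E) x x))).source := by
      rw [extChartAt_model_space_eq_id, PartialEquiv.refl_source]
      exact mapsTo_univ _ _
    rw [mdifferentiableOn_iff_of_subset_source' hs h2s, extChartAt_model_space_eq_id,
      PartialEquiv.refl_coe, Function.id_comp]
    refine hgd.differentiableOn.congr ?_
    rintro _ ⟨y, hy, rfl⟩
    simp only [Function.comp_apply, (extChartAt 𝓘(ℂ, E) x).left_inv (hs hy)]
  · ext y
    simp only [mem_inter_iff, mem_singleton_iff, mem_preimage, Function.comp_apply, hg, map_sub,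
      sub_eq_zero]
    constructor
    · rintro ⟨rfl, hy⟩
      exact ⟨hy, rfl⟩
    · rintro ⟨hy, h⟩
      refine ⟨(extChartAt 𝓘(ℂ, E) x).injOn (hs hy) (mem_extChartAt_source x) (L.injective h), hy⟩
  · have heq : (g ∘ extChartAt 𝓘(ℂ, E) x) ∘ (extChartAt 𝓘(ℂ, E) x).symm =ᶠ[𝓝 (extChartAt 𝓘(ℂ, E) x x)]
        g := by
      filter_upwards [extChartAt_target_mem_nhds (I := 𝓘(ℂ, E)) x] with e he
      simp only [Function.comp_apply, (extChartAt 𝓘(ℂ, E) x).right_inv he]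
    have hga : DifferentiableAt ℂ ((g ∘ extChartAt 𝓘(ℂ, E) x) ∘ (extChartAt 𝓘(ℂ, E) x).symm)
        (extChartAt 𝓘(ℂ, E) x x) :=
      (hgd.differentiableAt).congr_of_eventuallyEq heq
    rw [surjective_mfderiv_iff_extChartAt (mem_extChartAt_source x) hga, heq.fderiv_eq]
    have hfd : HasFDerivAt g ((L : E →L[ℂ] (Fin (Module.finrank ℂ E) → ℂ)).comp
        (ContinuousLinearMap.id ℂ E)) (extChartAt 𝓘(ℂ, E) x x) :=
      (L : E →L[ℂ] (Fin (Module.finrank ℂ E) → ℂ)).hasFDerivAt.comp _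
        ((hasFDerivAt_id _).sub_const _)
    rw [hfd.fderiv, ContinuousLinearMap.comp_id]
    exact L.surjective

end Independence

/-! ### Trianalytic subsets -/

/-- **`Z` has quaternionic tangent space at `x`**: for every regular presentation `f` of `Z` at `x`
(`Z = {f = 0}` near `x`, `df_x` onto), the tangent space `T_x Z = ker df_x` is invariant under every
induced complex structure `L = aI + bJ + cK` — Verbitsky's "`L(T_x N) = T_x N`" at the non-singular
point `x`. Vacuous where `Z` has no regular presentation (singular points, points off `Z`), as in the
source, where the condition is imposed on `N⁰` only; independent of the presentation
(`IsRegularPresentation.hasQuaternionicTangentAt_iff`).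
[cite: Verbitsky1995Trianalytic, §4 Prop. (N is analytic iff eta is constant) (arXiv §3)] -/
def HasQuaternionicTangentAt (J K : ∀ x : M, TangentSpace 𝓘(ℝ, E) x →L[ℝ] TangentSpace 𝓘(ℝ, E) x)
    (Z : Set M) (x : M) : Prop :=
  ∀ ⦃p : ℕ⦄ ⦃U : Set M⦄ ⦃f : M → (Fin p → ℂ)⦄, IsRegularPresentation E Z x U f →
    IsQuaternionicAt J K x (tangentKer E f x)

/-- **Trianalytic subset of the hyperkähler manifold `(M, I, J, K)` (Verbitsky).** In print: "a closed
subset `N ⊂ M` is called trianalytic if `N` is a complex analytic subset of `(M, L)` for any induced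
complex structure `L`". Rendered through Verbitsky's own criterion (loc. cit., Proposition "`N` is
analytic iff `η` is constant" with Wirtinger's equality case: a closed analytic `N ⊂ (M, I)` is
analytic with respect to the induced complex structure `L` iff `L(T_x N) = T_x N` at every
non-singular point `x`): **`Z` is a closed analytic subset of the complex manifold `(M, I)`
(`IsAnalyticSet 𝓘(ℂ, E) Z`) and at every point of `Z` every regular presentation has a tangent space
`T_x Z = ker df_x` invariant under all induced complex structures `aI + bJ + cK`** (equivalently, for
a hyperkähler triple, under `J`: `IsHyperkaehlerTriple.isTrianalytic_iff`). The induced complex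
structures of the tree carry no holomorphic atlas, so the literal wording (which needs the
Newlander–Nirenberg theorem to produce `L`-holomorphic functions) is not the definition; the
equivalence is Verbitsky's Proposition, not re-proved here.
[cite: Verbitsky1995Trianalytic, §1 and §4 Definition (tri-analytic subsets) (arXiv §0 and §3)]
[cite: Verbitsky1997HyperholomorphicSheaves, §2.3 (Definition)] -/
def IsTrianalytic (J K : ∀ x : M, TangentSpace 𝓘(ℝ, E) x →L[ℝ] TangentSpace 𝓘(ℝ, E) x)
    (Z : Set M) : Prop :=
  IsAnalyticSet 𝓘(ℂ, E) Z ∧ ∀ x ∈ Z, HasQuaternionicTangentAt J K Z x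

section Trianalytic

variable {J K : ∀ x : M, TangentSpace 𝓘(ℝ, E) x →L[ℝ] TangentSpace 𝓘(ℝ, E) x}

/-- A trianalytic subset is an analytic subset of `(M, I)`.
[cite: Verbitsky1995Trianalytic, §4 (arXiv §3)] -/
theorem IsTrianalytic.isAnalyticSet {Z : Set M} (h : IsTrianalytic J K Z) : IsAnalyticSet 𝓘(ℂ, E) Z :=
  h.1

/-- A trianalytic subset is closed. [cite: Verbitsky1995Trianalytic, §4 (arXiv §3)] -/
theorem IsTrianalytic.isClosed {Z : Set M} (h : IsTrianalytic J K Z) : IsClosed Z :=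
  h.1.isClosed

/-- The tangent spaces of a trianalytic subset at its points are quaternionic.
[cite: Verbitsky1995Trianalytic, §4 (arXiv §3)] -/
theorem IsTrianalytic.hasQuaternionicTangentAt {Z : Set M} (h : IsTrianalytic J K Z) {x : M}
    (hx : x ∈ Z) : HasQuaternionicTangentAt J K Z x :=
  h.2 x hx

/-- Unfolding: for a trianalytic `Z` and a regular presentation `f` at `x ∈ Z`, `ker df_x` is
invariant under every `aI + bJ + cK`. [cite: Verbitsky1995Trianalytic, §4 (arXiv §3)] -/
theorem IsTrianalytic.inducedJ_mem_tangentKer {Z U : Set M} (h : IsTrianalytic J K Z) {x : M}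
    (hx : x ∈ Z) {p : ℕ} {f : M → (Fin p → ℂ)} (hf : IsRegularPresentation E Z x U f) (a b c : ℝ)
    {v : TangentSpace 𝓘(ℝ, E) x} (hv : v ∈ tangentKer E f x) :
    inducedJ J K a b c x v ∈ tangentKer E f x :=
  (h.2 x hx hf).inducedJ_mem a b c hv

/-- At a point of `Z` which is not a regular point (no regular presentation: a singular point) the
tangent condition is vacuous, as in the source, where it is imposed on the non-singular locus `N⁰`.
[folklore] -/
theorem hasQuaternionicTangentAt_of_not_mem_regularLocus {Z : Set M} {x : M} (hxZ : x ∈ Z)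
    (hx : x ∉ regularLocus 𝓘(ℂ, E) Z) : HasQuaternionicTangentAt J K Z x := by
  intro p U f hf
  exact (hx (hf.mem_regularLocus hxZ)).elim

/-- **Reduction to `J`** (for a hyperkähler triple): `Z` has quaternionic tangent space at `x` iff
for every regular presentation `ker df_x` is `J`-invariant — `I`-invariance is automatic (`df_x` is
`ℂ`-linear) and `K = IJ`. This is Verbitsky's formulation "`J(T_x N) = T_x N`".
[cite: Verbitsky1995Trianalytic, §4 Prop. (N is analytic iff eta is constant) (arXiv §3)] -/
theorem IsHyperkaehlerTriple.hasQuaternionicTangentAt_iff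
    {g : RiemannianMetric (fun x : M ↦ TangentSpace 𝓘(ℝ, E) x)} (h : IsHyperkaehlerTriple g J K)
    (Z : Set M) (x : M) :
    HasQuaternionicTangentAt J K Z x ↔
      ∀ ⦃p : ℕ⦄ ⦃U : Set M⦄ ⦃f : M → (Fin p → ℂ)⦄, IsRegularPresentation E Z x U f →
        ∀ v ∈ tangentKer E f x, J x v ∈ tangentKer E f x :=
  ⟨fun H _ _ _ hf _ hv ↦ (H hf).J_mem hv, fun H _ _ _ hf ↦
    h.isQuaternionicAt_of_tangentJ_mem_of_J_mem x (fun _ hv ↦ tangentJ_mem_tangentKer hv) (H hf)⟩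

/-- **Trianalytic = analytic with `J`-invariant tangent spaces** (for a hyperkähler triple):
Verbitsky's criterion in its printed form, "`N` closed analytic in `(M, I)` and `J(T_x N) = T_x N`
for every non-singular point `x`". [cite: Verbitsky1995Trianalytic, §4 Prop. (N is analytic iff eta is constant) (arXiv §3)] -/
theorem IsHyperkaehlerTriple.isTrianalytic_iff
    {g : RiemannianMetric (fun x : M ↦ TangentSpace 𝓘(ℝ, E) x)} (h : IsHyperkaehlerTriple g J K)
    (Z : Set M) :
    IsTrianalytic J K Z ↔ IsAnalyticSet 𝓘(ℂ, E) Z ∧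
      ∀ x ∈ Z, ∀ ⦃p : ℕ⦄ ⦃U : Set M⦄ ⦃f : M → (Fin p → ℂ)⦄, IsRegularPresentation E Z x U f →
        ∀ v ∈ tangentKer E f x, J x v ∈ tangentKer E f x :=
  and_congr Iff.rfl (forall₂_congr fun x _ ↦ h.hasQuaternionicTangentAt_iff Z x)

/-- The empty set is trianalytic. [folklore] -/
theorem isTrianalytic_empty (J K : ∀ x : M, TangentSpace 𝓘(ℝ, E) x →L[ℝ] TangentSpace 𝓘(ℝ, E) x) :
    IsTrianalytic J K (∅ : Set M) :=
  ⟨isAnalyticSet_empty, fun _ hx ↦ hx.elim⟩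

/-- The whole manifold is trianalytic (a presentation of `univ` near `x` vanishes identically near
`x`, so `ker df_x = T_x M`). [folklore] -/
theorem isTrianalytic_univ (J K : ∀ x : M, TangentSpace 𝓘(ℝ, E) x →L[ℝ] TangentSpace 𝓘(ℝ, E) x) :
    IsTrianalytic J K (univ : Set M) := by
  refine ⟨isAnalyticSet_univ, fun x _ ↦ ?_⟩
  intro p U f hf
  have hzero : f =ᶠ[𝓝 x] fun _ ↦ 0 := by
    filter_upwards [hf.isOpen.mem_nhds hf.mem] with z hz
    exact hf.apply_eq_zero (mem_univ z) hz
  rw [tangentKer_eq_top (by rw [hzero.mfderiv_eq]; exact mfderiv_const)]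
  exact isQuaternionicAt_top J K x

variable [FiniteDimensional ℂ E] [IsManifold 𝓘(ℂ, E) 1 M]

/-- **Presentation independence**: at a point `x ∈ Z` with a regular presentation `f`, `Z` has
quaternionic tangent space iff `ker df_x` is quaternionic for THIS presentation.
[cite: Chirka1989, §2.3] -/
theorem IsRegularPresentation.hasQuaternionicTangentAt_iff {Z U : Set M} {x : M} {p : ℕ}
    {f : M → (Fin p → ℂ)} (hx : x ∈ Z) (hf : IsRegularPresentation E Z x U f) :
    HasQuaternionicTangentAt J K Z x ↔ IsQuaternionicAt J K x (tangentKer E f x) :=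
  ⟨fun H ↦ H hf, fun H _ _ _ hg ↦ by rwa [hg.tangentKer_eq hx hf]⟩

/-- **One-point sets are trianalytic**: `{x₀}` is analytic (`isAnalyticSet_singleton`) and at `x₀`
every regular presentation has codimension `dim E` (uniqueness of the codimension against the
presentation `exists_isRegularPresentation_singleton`), so its onto differential `E → ℂ^{dim E}` is
injective and `T_{x₀}{x₀} = ker df = 0`, which is quaternionic. [folklore] -/
theorem isTrianalytic_singleton
    (J K : ∀ x : M, TangentSpace 𝓘(ℝ, E) x →L[ℝ] TangentSpace 𝓘(ℝ, E) x) (x₀ : M) :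
    IsTrianalytic J K ({x₀} : Set M) := by
  refine ⟨isAnalyticSet_singleton x₀, fun x hx ↦ ?_⟩
  intro p U f hf
  rw [mem_singleton_iff] at hx
  subst hx
  obtain ⟨g, hg⟩ := exists_isRegularPresentation_singleton (E := E) x
  have hp : p = Module.finrank ℂ E :=
    hf.isRegularPointOfCodim.codim_unique (mem_singleton x) hg.isRegularPointOfCodim
  have hinj : Function.Injective
      (show E →L[ℂ] (Fin p → ℂ) from mfderiv 𝓘(ℂ, E) 𝓘(ℂ, Fin p → ℂ) f x) := by
    refine (LinearMap.injective_iff_surjective_of_finrank_eq_finrank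
      (f := ((show E →L[ℂ] (Fin p → ℂ) from mfderiv 𝓘(ℂ, E) 𝓘(ℂ, Fin p → ℂ) f x) :
        E →ₗ[ℂ] (Fin p → ℂ))) ?_).2 hf.surjective
    rw [Module.finrank_fin_fun, hp]
  have hbot : tangentKer E f x = ⊥ := by
    rw [eq_bot_iff]
    intro v hv
    rw [mem_tangentKer] at hv
    rw [Submodule.mem_bot]
    exact (injective_iff_map_eq_zero
      (show E →L[ℂ] (Fin p → ℂ) from mfderiv 𝓘(ℂ, E) 𝓘(ℂ, Fin p → ℂ) f x)).1 hinj v hv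
  rw [hbot]
  exact isQuaternionicAt_bot J K x

end Trianalytic

end Literature.Geometry.Hyperkaehler

end
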